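import Summits.QuantumFields.YangMills.Theorems.BalabanUVNodesN15KingModelPotentialComplexLimitLetters
import Summits.QuantumFields.YangMills.Theorems.BalabanUVNodesN15KingModelPotentialAnalyticLimit

/-!
# N15 (NE2) King-model rung, PART 36 — THE LETTERS ALONG COMPLEX LINES THROUGH A REAL BACKGROUND (base-point-free edition of 32∕33):
# locality, the η-rate with decay and the continuum limit at `v₀ + z·v₁`, `v₀, v₁` real towers, `z` complex

Eleventh generation (g11) of the seat `pub-ymgap-dag-n15-d`, part 36 (on 33 `…PotentialComplexLimitLetters` and 30 `…PotentialAnalyticLimit`).  Parts 32∕33 sit at the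
base point `v₀ = 0` (the complex coupling `z·v`); [B9] Theorem 3.4 is used AROUND A NONZERO REAL BACKGROUND: the operators at `U′U`, `U` real, `U′` complex and
small.  In King's A = 0 model the analogue is the complex LINE `v₀ + z·v₁` through a real potential tower `v₀` in a real direction `v₁` — part 30's setting
(`analyticAt_kingCovCPot_line`, `kingCovCPot_line_ofReal`, `king_continuumLimit_holomorphic_at`).  The REAL points `z = t` of the line are the real towers
`v₀ + t·v₁`, where 33 §1 (`kingCovE_fullPert_decay`) and 10e (`covarianceTowerRate_fullPert`) apply; the two-constants theorem (tree's
`B13RealSliceEntryLetters.decay_of_realSlice realStructureComplex`, BY NAME) carries them to the disc `‖z‖ < (r∕(1+r))·min((r_K − u₀)∕u₁, 1)`: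

* §1 `abs_line_le_abs`, `coherence_line_le_abs` (size and coherence of `v₀ + t·v₁` for real `t` of either sign), `line_radius_facts`;
* §2 ★★ `kingCovCPot_line_apply_decay` — (4.34)(i) ALONG THE LINE: `‖C^{(k)}_{v₀+z·v₁}(x,y)‖ ≤ (4∕γ₀)·e^{−(1−λ(r))κ|x−y|_T}`, k-uniform;
* §3 ★★★ `kingCovCPot_line_twoSpacing_rate` — (4.38) ALONG THE LINE WITH DECAY AND ONE EXPONENT:
  `‖C^{(k+1)}_{v₀+z·v₁}(x,y) − C^{(k)}_{v₀+z·v₁}(x,y)‖ ≤ (C·θ^k)^{1−λ(r)}·M^{λ(r)}·e^{−(1−λ(r))(κ∕2)|x−y|_T}` (`θ = L^{−1∕4}`, `M = max(C, 4∕γ₀)`);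
* §4 ★★ `kingCovCPot_line_lim_letters` — the continuum limit ALONG THE LINE (30's Vitali limit) is local and is approached geometrically with decay.

References (method): two-constants theorem [Ransford1995, Thm. 4.3.7] via the tree's `TwoConstantsDisc` ∕ `B13RealSliceEntryLetters` (BY NAME); template [B9]
Thm 3.4 p.400, (3.64)–(3.65) p.402; King (4.34), Lemma 4.5 (4.38) p.674, §4 pp.675–676.

HONEST SCOPE.  King's A = 0 SCALAR model on the King-admissible tori (odd `L ≥ 3`, `a, m² > 0`); REAL base and direction towers (bounded, coherent) and ONE
complex parameter along the line — not a general complex tower (no coherence notion is claimed for complex towers); NOT a gauge field ∕ Bałaban's `U′U` ∕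
`C^{(k)}(Λ;U)`; NOT a node discharge; count-neutral.  No `sorry`, standard axioms.
-/

noncomputable section

open scoped BigOperators Matrix
open Filter Topology Metric Finset Complex

namespace Summit.QuantumFields.YangMills.BalabanUVNodes.N15.KingModel

open Literature.MathematicalPhysics.QuantumFieldTheory.Balaban1983to89 hiding blockOf
open Literature.MathematicalPhysics.QuantumFieldTheory.Balaban1983to89.B5Prop11Plancherel (Tor fine)
open Literature.MathematicalPhysics.QuantumFieldTheory.Balaban1983to89.B13RealSliceEntryLetters (lam lam_nonneg lam_lt_one lam_le
  decay_of_realSlice realStructureComplex)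
open Literature.MathematicalPhysics.QuantumFieldTheory.King1986.Torus (gam0L gam0L_pos tdistT tdistT_isPseudoDist)
open Summit.QuantumFields.BalabanUV.T4Continuum.NE2KingTransplant (IsPseudoMetric)
open Summit.QuantumFields.YangMills.BalabanUVNodes.N15KingModelRung.Curved (underPtN)

variable {d : ℕ}

section Line

variable (L : ℕ) [NeZero L]

/-! ## §1 The real points of the line: size and coherence of `v₀ + t·v₁` for real `t` -/

omit [NeZero L] in
/-- The size of the real tower `v₀ + t·v₁` for a real `t` of either sign: `≤ u₀ + |t|·u₁`. [folklore] -/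
theorem abs_line_le_abs {e : ℕ} {v₀ v₁ : ∀ N : ℕ, Tor (fine N (kingU d L e)) → ℝ} {u₀ u₁ : ℝ} (t : ℝ)
    (hv₀ : ∀ (N : ℕ) (x : Tor (fine N (kingU d L e))), |v₀ N x| ≤ u₀) (hv₁ : ∀ (N : ℕ) (x : Tor (fine N (kingU d L e))), |v₁ N x| ≤ u₁)
    (N : ℕ) (x : Tor (fine N (kingU d L e))) : |(v₀ + t • v₁) N x| ≤ u₀ + |t| * u₁ := by
  show |v₀ N x + t * v₁ N x| ≤ u₀ + |t| * u₁
  calc |v₀ N x + t * v₁ N x| ≤ |v₀ N x| + |t * v₁ N x| := abs_add_le _ _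
    _ ≤ u₀ + |t| * u₁ := by
        rw [abs_mul]
        exact add_le_add (hv₀ N x) (mul_le_mul_of_nonneg_left (hv₁ N x) (abs_nonneg t))

omit [NeZero L] in
/-- The coherence defect of the real tower `v₀ + t·v₁` for a real `t` of either sign: `≤ (ν₀ + |t|·ν₁)·s^k`. [folklore] -/
theorem coherence_line_le_abs {e : ℕ} {v₀ v₁ : ∀ N : ℕ, Tor (fine N (kingU d L e)) → ℝ} {ν₀ ν₁ s : ℝ} (t : ℝ)
    (hcoh₀ : ∀ (k : ℕ), 1 ≤ k → ∀ x' : Tor (fine (L ^ 1 * L ^ k) (kingU d L e)),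
      |v₀ (L ^ 1 * L ^ k) x' - v₀ (L ^ k) (underPtN L k 1 (kingU d L e) x')| ≤ ν₀ * s ^ k)
    (hcoh₁ : ∀ (k : ℕ), 1 ≤ k → ∀ x' : Tor (fine (L ^ 1 * L ^ k) (kingU d L e)),
      |v₁ (L ^ 1 * L ^ k) x' - v₁ (L ^ k) (underPtN L k 1 (kingU d L e) x')| ≤ ν₁ * s ^ k)
    (k : ℕ) (hk : 1 ≤ k) (x' : Tor (fine (L ^ 1 * L ^ k) (kingU d L e))) :
    |(v₀ + t • v₁) (L ^ 1 * L ^ k) x' - (v₀ + t • v₁) (L ^ k) (underPtN L k 1 (kingU d L e) x')| ≤ (ν₀ + |t| * ν₁) * s ^ k := by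
  show |v₀ (L ^ 1 * L ^ k) x' + t * v₁ (L ^ 1 * L ^ k) x' - (v₀ (L ^ k) (underPtN L k 1 (kingU d L e) x')
    + t * v₁ (L ^ k) (underPtN L k 1 (kingU d L e) x'))| ≤ (ν₀ + |t| * ν₁) * s ^ k
  have e1 : v₀ (L ^ 1 * L ^ k) x' + t * v₁ (L ^ 1 * L ^ k) x' - (v₀ (L ^ k) (underPtN L k 1 (kingU d L e) x')
      + t * v₁ (L ^ k) (underPtN L k 1 (kingU d L e) x'))
      = (v₀ (L ^ 1 * L ^ k) x' - v₀ (L ^ k) (underPtN L k 1 (kingU d L e) x'))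
        + t * (v₁ (L ^ 1 * L ^ k) x' - v₁ (L ^ k) (underPtN L k 1 (kingU d L e) x')) := by ring
  rw [e1]
  refine (abs_add_le _ _).trans ?_
  rw [abs_mul, add_mul, mul_assoc]
  exact add_le_add (hcoh₀ k hk x') (mul_le_mul_of_nonneg_left (hcoh₁ k hk x') (abs_nonneg t))

omit [NeZero L] in
/-- The line radius `R₁ = min((r_K − u₀)∕u₁, 1)`: the disc `‖z‖ < (r∕(1+r))·R₁` lies in `ball 0 R₁`, and on `ball 0 R₁` the complex line stays in 29's
sup-ball (`u₀ + ‖z‖u₁ ≤ r_K`) and `‖z‖ < 1`. [folklore] -/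
theorem line_radius_facts {a m2 u₀ u₁ r : ℝ} (hr0 : 0 < r) (hu₁ : 0 < u₁) (hu₀K : u₀ < cplxWindow d a m2 L) :
    r / (1 + r) * min ((cplxWindow d a m2 L - u₀) / u₁) 1 ≤ min ((cplxWindow d a m2 L - u₀) / u₁) 1 ∧
      ∀ z : ℂ, z ∈ ball (0 : ℂ) (min ((cplxWindow d a m2 L - u₀) / u₁) 1) → u₀ + ‖z‖ * u₁ ≤ cplxWindow d a m2 L ∧ ‖z‖ < 1 := by
  have hR : 0 < (cplxWindow d a m2 L - u₀) / u₁ := div_pos (by linarith) hu₁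
  refine ⟨?_, fun z hz => ?_⟩
  · have h1 : r / (1 + r) ≤ 1 := (div_le_one (by linarith)).2 (by linarith)
    have h2 : 0 ≤ min ((cplxWindow d a m2 L - u₀) / u₁) 1 := le_min hR.le zero_le_one
    calc r / (1 + r) * min ((cplxWindow d a m2 L - u₀) / u₁) 1 ≤ 1 * min ((cplxWindow d a m2 L - u₀) / u₁) 1 :=
          mul_le_mul_of_nonneg_right h1 h2
      _ = _ := one_mul _
  · rw [mem_ball_zero_iff] at hz
    refine ⟨?_, lt_of_lt_of_le hz (min_le_right _ _)⟩
    have hz' : ‖z‖ < (cplxWindow d a m2 L - u₀) / u₁ := lt_of_lt_of_le hz (min_le_left _ _)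
    have : ‖z‖ * u₁ < (cplxWindow d a m2 L - u₀) / u₁ * u₁ := mul_lt_mul_of_pos_right hz' hu₁
    rw [div_mul_cancel₀ _ hu₁.ne'] at this
    linarith

/-- **Holomorphy of the covariance along the complex line on the line ball** (30 `analyticAt_kingCovCPot_line` + `norm_cline_le`). [cite: Balaban1985BackgroundPropagators, Thm 3.4 p.400 (template)] -/
theorem differentiableOn_kingCovCPot_line {a m2 : ℝ} (ha : 0 < a) (hm : 0 < m2) (hL : 2 ≤ L) {e : ℕ} {k : ℕ} (hk : 1 ≤ k)
    {v₀ v₁ : ∀ N : ℕ, Tor (fine N (kingU d L e)) → ℝ} {u₀ u₁ : ℝ} (hu₀ : 0 ≤ u₀) (hu₁ : 0 < u₁) (hu₀K : u₀ < cplxWindow d a m2 L)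
    (hv₀ : ∀ (N : ℕ) (x : Tor (fine N (kingU d L e))), |v₀ N x| ≤ u₀) (hv₁ : ∀ (N : ℕ) (x : Tor (fine N (kingU d L e))), |v₁ N x| ≤ u₁)
    (x y : Tor (kingU d L e)) :
    DifferentiableOn ℂ (fun ζ : ℂ => kingCovCPot d a m2 L (kingM d L e) k (fun x' => (v₀ (L ^ k) x' : ℂ) + ζ * (v₁ (L ^ k) x' : ℂ)) x y)
      (ball 0 (min ((cplxWindow d a m2 L - u₀) / u₁) 1)) := by
  intro z hz
  obtain ⟨-, hball⟩ := line_radius_facts (d := d) (a := a) (m2 := m2) L one_pos hu₁ hu₀K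
  obtain ⟨hzK, -⟩ := hball z hz
  have hz0 : 0 ≤ u₀ + ‖z‖ * u₁ := by positivity
  exact (analyticAt_kingCovCPot_line (M := kingM d L e) ha hm hL hk _ _ hz0 (norm_cline_le L hv₀ hv₁ z _) hzK x y)
    |>.differentiableAt.differentiableWithinAt

/-! ## §2 (4.34)(i) along the line -/

/-- ★★ **(4.34)(i) ALONG A COMPLEX LINE THROUGH A REAL BACKGROUND.**  For odd `L ≥ 3`, `a, m² > 0` there are `κ, w₁ > 0` such that for every volume
exponent `e`, all real towers `v₀` (base) and `v₁` (direction) with `sup|v₀| ≤ u₀ < r_K`, `sup|v₁| ≤ u₁`, `u₁ > 0`, `u₀ + u₁ ≤ w₁`, coherence defects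
`≤ ν₀s^k`, `≤ ν₁s^k` (`ν₀ + ν₁ ≤ w₁`, `0 ≤ s ≤ L^{−1∕2}`), all sites, every `k ≥ 1`, every `0 < r < 1` and every `z` with
`‖z‖ < (r∕(1+r))·min((r_K − u₀)∕u₁, 1)`:  `‖C^{(k)}_{v₀ + z·v₁}(x,y)‖ ≤ (4∕γ₀)·e^{−(1−λ(r))κ|x−y|_T}` (33 §1 on the real towers `v₀ + t·v₁`, 29's bound on the
line ball, `decay_of_realSlice` BY NAME). [cite: Balaban1985BackgroundPropagators, Thm 3.4 p.400, (3.108) p.416 (template); King1986, (4.34) p.674 (A = 0); Ransford1995, Thm. 4.3.7] -/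
theorem kingCovCPot_line_apply_decay (hLodd : Odd L) (hL : 2 ≤ L) {a m2 : ℝ} (ha : 0 < a) (hm : 0 < m2) :
    ∃ κ w₁ : ℝ, 0 < κ ∧ 0 < w₁ ∧
      ∀ (e : ℕ) (v₀ v₁ : ∀ N : ℕ, Tor (fine N (kingU d L e)) → ℝ) (u₀ u₁ ν₀ ν₁ s : ℝ),
      0 ≤ ν₀ → 0 ≤ ν₁ → ν₀ + ν₁ ≤ w₁ → 0 ≤ s → s ≤ (L : ℝ) ^ (-(1 / 2 : ℝ)) →
      0 ≤ u₀ → 0 < u₁ → u₀ < cplxWindow d a m2 L → u₀ + u₁ ≤ w₁ →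
      (∀ (N : ℕ) (x : Tor (fine N (kingU d L e))), |v₀ N x| ≤ u₀) → (∀ (N : ℕ) (x : Tor (fine N (kingU d L e))), |v₁ N x| ≤ u₁) →
      (∀ (k : ℕ), 1 ≤ k → ∀ x' : Tor (fine (L ^ 1 * L ^ k) (kingU d L e)),
          |v₀ (L ^ 1 * L ^ k) x' - v₀ (L ^ k) (underPtN L k 1 (kingU d L e) x')| ≤ ν₀ * s ^ k) →
      (∀ (k : ℕ), 1 ≤ k → ∀ x' : Tor (fine (L ^ 1 * L ^ k) (kingU d L e)),
          |v₁ (L ^ 1 * L ^ k) x' - v₁ (L ^ k) (underPtN L k 1 (kingU d L e) x')| ≤ ν₁ * s ^ k) →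
      ∀ (x y : Tor (kingU d L e)) (k : ℕ), 1 ≤ k → ∀ (r : ℝ), 0 < r → r < 1 →
      ∀ z : ℂ, ‖z‖ < r / (1 + r) * min ((cplxWindow d a m2 L - u₀) / u₁) 1 →
        ‖kingCovCPot d a m2 L (kingM d L e) k (fun x' => (v₀ (L ^ k) x' : ℂ) + z * (v₁ (L ^ k) x' : ℂ)) x y‖
          ≤ 4 / gam0L (d + 1) a L * Real.exp (-((1 - lam r) * κ * tdistT (kingU d L e) x y)) := by
  obtain ⟨κ, w₁, hκ, hw₁, H⟩ := kingCovE_fullPert_decay (d := d) L hLodd hL ha hm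
  refine ⟨κ, w₁, hκ, hw₁, ?_⟩
  intro e v₀ v₁ u₀ u₁ ν₀ ν₁ s hν₀ hν₁ hνw hs0 hs1 hu₀ hu₁ hu₀K huw hv₀ hv₁ hcoh₀ hcoh₁ x y k hk r hr0 hr1 z hz
  have hγ := gam0L_pos (d := d + 1) ha hL
  set R₁ : ℝ := min ((cplxWindow d a m2 L - u₀) / u₁) 1 with hR₁
  obtain ⟨-, hball⟩ := line_radius_facts (d := d) (a := a) (m2 := m2) L hr0 hu₁ hu₀K
  set B : ℝ := 4 / gam0L (d + 1) a L with hB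
  have hB0 : 0 ≤ B := by positivity
  set K : ℂ → Matrix (Tor (kingU d L e)) (Tor (kingU d L e)) ℂ := fun ζ =>
    kingCovCPot d a m2 L (kingM d L e) k (fun x' => (v₀ (L ^ k) x' : ℂ) + ζ * (v₁ (L ^ k) x' : ℂ)) with hK
  have hKd : ∀ i j, DifferentiableOn ℂ (fun ζ => K ζ i j) (ball (0 : ℂ) R₁) := fun i j =>
    differentiableOn_kingCovCPot_line (d := d) L ha hm hL hk hu₀ hu₁ hu₀K hv₀ hv₁ i j
  have hKM : ∀ ζ ∈ ball (0 : ℂ) R₁, ∀ i j, ‖K ζ i j‖ ≤ B := by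
    intro ζ hζ i j
    obtain ⟨hζK, -⟩ := hball ζ hζ
    have hz0 : 0 ≤ u₀ + ‖ζ‖ * u₁ := by positivity
    have h := kingCovCPot_apply_norm_le (M := kingM d L e) ha hm hL hk hz0 (norm_cline_le L hv₀ hv₁ ζ _) hζK i j
    refine h.trans ?_
    rw [hB, div_le_div_iff_of_pos_right hγ]
    norm_num
  have hKB : ∀ ζ ∈ realStructureComplex.Ereal, ‖ζ‖ < R₁ → ∀ i j, ‖K ζ i j‖ ≤ B * Real.exp (-(κ * tdistT (kingU d L e) i j)) := by
    intro ζ hζ hζR i j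
    obtain ⟨t, rfl, ht1⟩ := exists_real_of_mem_Ereal hζ (min_le_right _ _) hζR
    have hvt := abs_line_le_abs L (u₀ := u₀) (u₁ := u₁) t hv₀ hv₁
    have hcoht := coherence_line_le_abs L (ν₀ := ν₀) (ν₁ := ν₁) (s := s) t hcoh₀ hcoh₁
    have htw : u₀ + |t| * u₁ ≤ w₁ := by nlinarith [abs_nonneg t]
    have htν : ν₀ + |t| * ν₁ ≤ w₁ := by nlinarith [abs_nonneg t]
    have htν0 : 0 ≤ ν₀ + |t| * ν₁ := by positivity
    have hdec := H e (v₀ + t • v₁) (u₀ + |t| * u₁) (ν₀ + |t| * ν₁) s htν0 htν hs0 hs1 hvt htw hcoht k i j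
    show ‖kingCovCPot d a m2 L (kingM d L e) k (fun x' => (v₀ (L ^ k) x' : ℂ) + (t : ℂ) * (v₁ (L ^ k) x' : ℂ)) i j‖ ≤ _
    rw [kingCovCPot_line_ofReal v₀ v₁ hk t i j, Complex.norm_real, Real.norm_eq_abs]
    exact hdec
  have hdist : ∀ i j : Tor (kingU d L e), 0 ≤ tdistT (kingU d L e) i j := (tdistT_isPseudoDist (kingU d L e)).nonneg
  have key := decay_of_realSlice realStructureComplex hKd hKM hKB hB0 le_rfl hκ.le hdist hr0 hr1 z (by rwa [mem_ball_zero_iff]) x y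
  refine key.trans (le_of_eq ?_)
  have hsum : (1 - lam r) + lam r = 1 := by ring
  rw [← Real.rpow_add' hB0 (by rw [hsum]; exact one_ne_zero), hsum, Real.rpow_one]

/-! ## §3 (4.38) along the line, with decay and one exponent -/

/-- ★★★ **(4.38) ALONG A COMPLEX LINE THROUGH A REAL BACKGROUND — NE2's η-RATE WITH DECAY, ONE EXPONENT UNIFORM ON THE DISC.**  For odd `L ≥ 3`,
`a, m² > 0` there are `κ, w₁, C > 0` such that, with the data of `kingCovCPot_line_apply_decay`, for every `z` with `‖z‖ < (r∕(1+r))·min((r_K − u₀)∕u₁, 1)`: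
`‖C^{(k+1)}_{v₀+z·v₁}(x,y) − C^{(k)}_{v₀+z·v₁}(x,y)‖ ≤ (C·θ^k)^{1−λ(r)}·M^{λ(r)}·e^{−(1−λ(r))(κ∕2)|x−y|_T}`, `θ = L^{−1∕4}`, `M = max(C, 4∕γ₀)` — 10e's real rate on the
real towers `v₀ + t·v₁`, 29's bound on the line ball, `decay_of_realSlice` BY NAME; part 32's `kingCov_twoSpacing_complexRate_uniform` is the base point `v₀ = 0`.
[cite: King1986, Lemma 4.5 (4.38) p.674 (A = 0 template); Balaban1985BackgroundPropagators, Thm 3.4 p.400, (3.64)–(3.65) p.402; Ransford1995, Thm. 4.3.7] -/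
theorem kingCovCPot_line_twoSpacing_rate (hLodd : Odd L) (hL : 2 ≤ L) {a m2 : ℝ} (ha : 0 < a) (hm : 0 < m2) :
    ∃ κ w₁ C : ℝ, 0 < κ ∧ 0 < w₁ ∧ 0 < C ∧
      ∀ (e : ℕ) (v₀ v₁ : ∀ N : ℕ, Tor (fine N (kingU d L e)) → ℝ) (u₀ u₁ ν₀ ν₁ s : ℝ),
      0 ≤ ν₀ → 0 ≤ ν₁ → ν₀ + ν₁ ≤ w₁ → 0 ≤ s → s ≤ (L : ℝ) ^ (-(1 / 2 : ℝ)) →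
      0 ≤ u₀ → 0 < u₁ → u₀ < cplxWindow d a m2 L → u₀ + u₁ ≤ w₁ →
      (∀ (N : ℕ) (x : Tor (fine N (kingU d L e))), |v₀ N x| ≤ u₀) → (∀ (N : ℕ) (x : Tor (fine N (kingU d L e))), |v₁ N x| ≤ u₁) →
      (∀ (k : ℕ), 1 ≤ k → ∀ x' : Tor (fine (L ^ 1 * L ^ k) (kingU d L e)),
          |v₀ (L ^ 1 * L ^ k) x' - v₀ (L ^ k) (underPtN L k 1 (kingU d L e) x')| ≤ ν₀ * s ^ k) →
      (∀ (k : ℕ), 1 ≤ k → ∀ x' : Tor (fine (L ^ 1 * L ^ k) (kingU d L e)),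
          |v₁ (L ^ 1 * L ^ k) x' - v₁ (L ^ k) (underPtN L k 1 (kingU d L e) x')| ≤ ν₁ * s ^ k) →
      ∀ (x y : Tor (kingU d L e)) (k : ℕ), 1 ≤ k → ∀ (r : ℝ), 0 < r → r < 1 →
      ∀ z : ℂ, ‖z‖ < r / (1 + r) * min ((cplxWindow d a m2 L - u₀) / u₁) 1 →
        ‖kingCovCPot d a m2 L (kingM d L e) (k + 1) (fun x' => (v₀ (L ^ (k + 1)) x' : ℂ) + z * (v₁ (L ^ (k + 1)) x' : ℂ)) x y
            - kingCovCPot d a m2 L (kingM d L e) k (fun x' => (v₀ (L ^ k) x' : ℂ) + z * (v₁ (L ^ k) x' : ℂ)) x y‖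
          ≤ (C * (((L : ℝ) ^ (-(1 / 4 : ℝ))) ^ k)) ^ (1 - lam r) * (max C (4 / gam0L (d + 1) a L)) ^ lam r
              * Real.exp (-((1 - lam r) * (κ / 2) * tdistT (kingU d L e) x y)) := by
  obtain ⟨κ, w₁, C, hκ, hw₁, hC, H⟩ := covarianceTowerRate_fullPert (d := d) L hLodd hL ha hm
  refine ⟨κ, w₁, C, hκ, hw₁, hC, ?_⟩
  intro e v₀ v₁ u₀ u₁ ν₀ ν₁ s hν₀ hν₁ hνw hs0 hs1 hu₀ hu₁ hu₀K huw hv₀ hv₁ hcoh₀ hcoh₁ x y k hk r hr0 hr1 z hz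
  have hγ := gam0L_pos (d := d + 1) ha hL
  set θ : ℝ := (L : ℝ) ^ (-(1 / 4 : ℝ)) with hθ
  have hθ0 : 0 ≤ θ := Real.rpow_nonneg (Nat.cast_nonneg _) _
  have hθ1 : θ ≤ 1 := by
    have hL1 : (1 : ℝ) ≤ L := by exact_mod_cast (by omega : 1 ≤ L)
    exact Real.rpow_le_one_of_one_le_of_nonpos hL1 (by norm_num)
  have hk1 : 1 ≤ k + 1 := Nat.succ_le_succ (Nat.zero_le k)
  set R₁ : ℝ := min ((cplxWindow d a m2 L - u₀) / u₁) 1 with hR₁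
  obtain ⟨-, hball⟩ := line_radius_facts (d := d) (a := a) (m2 := m2) L hr0 hu₁ hu₀K
  set K : ℂ → Matrix (Tor (kingU d L e)) (Tor (kingU d L e)) ℂ := fun ζ =>
    kingCovCPot d a m2 L (kingM d L e) (k + 1) (fun x' => (v₀ (L ^ (k + 1)) x' : ℂ) + ζ * (v₁ (L ^ (k + 1)) x' : ℂ))
      - kingCovCPot d a m2 L (kingM d L e) k (fun x' => (v₀ (L ^ k) x' : ℂ) + ζ * (v₁ (L ^ k) x' : ℂ)) with hK
  have hKd : ∀ i j, DifferentiableOn ℂ (fun ζ => K ζ i j) (ball (0 : ℂ) R₁) := fun i j =>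
    (differentiableOn_kingCovCPot_line (d := d) L ha hm hL hk1 hu₀ hu₁ hu₀K hv₀ hv₁ i j).sub
      (differentiableOn_kingCovCPot_line (d := d) L ha hm hL hk hu₀ hu₁ hu₀K hv₀ hv₁ i j)
  have hKM : ∀ ζ ∈ ball (0 : ℂ) R₁, ∀ i j, ‖K ζ i j‖ ≤ max C (4 / gam0L (d + 1) a L) := by
    intro ζ hζ i j
    obtain ⟨hζK, -⟩ := hball ζ hζ
    have hz0 : 0 ≤ u₀ + ‖ζ‖ * u₁ := by positivity
    refine le_trans ?_ (le_max_right _ _)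
    calc ‖K ζ i j‖ ≤ ‖kingCovCPot d a m2 L (kingM d L e) (k + 1) (fun x' => (v₀ (L ^ (k + 1)) x' : ℂ) + ζ * (v₁ (L ^ (k + 1)) x' : ℂ)) i j‖
          + ‖kingCovCPot d a m2 L (kingM d L e) k (fun x' => (v₀ (L ^ k) x' : ℂ) + ζ * (v₁ (L ^ k) x' : ℂ)) i j‖ := by
          simp only [hK, Matrix.sub_apply]; exact norm_sub_le _ _
      _ ≤ 2 / gam0L (d + 1) a L + 2 / gam0L (d + 1) a L :=
          add_le_add (kingCovCPot_apply_norm_le (M := kingM d L e) ha hm hL hk1 hz0 (norm_cline_le L hv₀ hv₁ ζ _) hζK i j)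
            (kingCovCPot_apply_norm_le (M := kingM d L e) ha hm hL hk hz0 (norm_cline_le L hv₀ hv₁ ζ _) hζK i j)
      _ = 4 / gam0L (d + 1) a L := by ring
  have hKB : ∀ ζ ∈ realStructureComplex.Ereal, ‖ζ‖ < R₁ → ∀ i j,
      ‖K ζ i j‖ ≤ C * θ ^ k * Real.exp (-(κ / 2 * tdistT (kingU d L e) i j)) := by
    intro ζ hζ hζR i j
    obtain ⟨t, rfl, ht1⟩ := exists_real_of_mem_Ereal hζ (min_le_right _ _) hζR
    have hvt := abs_line_le_abs L (u₀ := u₀) (u₁ := u₁) t hv₀ hv₁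
    have hcoht := coherence_line_le_abs L (ν₀ := ν₀) (ν₁ := ν₁) (s := s) t hcoh₀ hcoh₁
    have htw : u₀ + |t| * u₁ ≤ w₁ := by nlinarith [abs_nonneg t]
    have htν : ν₀ + |t| * ν₁ ≤ w₁ := by nlinarith [abs_nonneg t]
    have htν0 : 0 ≤ ν₀ + |t| * ν₁ := by positivity
    obtain ⟨hrate, -⟩ := H e (v₀ + t • v₁) (u₀ + |t| * u₁) (ν₀ + |t| * ν₁) s htν0 htν hs0 hs1 hvt htw hcoht
    have hr := hrate k i j
    show ‖kingCovCPot d a m2 L (kingM d L e) (k + 1) (fun x' => (v₀ (L ^ (k + 1)) x' : ℂ) + (t : ℂ) * (v₁ (L ^ (k + 1)) x' : ℂ)) i j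
        - kingCovCPot d a m2 L (kingM d L e) k (fun x' => (v₀ (L ^ k) x' : ℂ) + (t : ℂ) * (v₁ (L ^ k) x' : ℂ)) i j‖ ≤ _
    rw [kingCovCPot_line_ofReal v₀ v₁ hk1 t i j, kingCovCPot_line_ofReal v₀ v₁ hk t i j, ← Complex.ofReal_sub, Complex.norm_real,
      Real.norm_eq_abs, abs_sub_comm]
    exact hr
  have hdist : ∀ i j : Tor (kingU d L e), 0 ≤ tdistT (kingU d L e) i j := (tdistT_isPseudoDist (kingU d L e)).nonneg
  have hB0 : 0 ≤ C * θ ^ k := by positivity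
  have hBM : C * θ ^ k ≤ max C (4 / gam0L (d + 1) a L) :=
    (mul_le_of_le_one_right hC.le (pow_le_one₀ hθ0 hθ1)).trans (le_max_left _ _)
  have key := decay_of_realSlice realStructureComplex hKd hKM hKB hB0 hBM (by positivity) hdist hr0 hr1 z (by rwa [mem_ball_zero_iff]) x y
  simpa only [hK, Matrix.sub_apply, mul_assoc] using key

/-! ## §4 The continuum limit along the line inherits the letters -/

/-- ★★ **THE CONTINUUM LIMIT ALONG A COMPLEX LINE THROUGH A REAL BACKGROUND IS LOCAL AND IS APPROACHED GEOMETRICALLY, WITH DECAY.**  For odd `L ≥ 3`,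
`a, m² > 0` there are `κ₁, κ₂, w₁, C > 0` such that, with the data of `kingCovCPot_line_apply_decay` (real towers `v₀, v₁`; `u₀ < r_K`, `u₀ + u₁ ≤ w₁`,
`ν₀ + ν₁ ≤ w₁`), for every `0 < r < 1`, every `z` with `‖z‖ < (r∕(1+r))·min((r_K − u₀)∕u₁, 1)`, all sites and every `k`, writing
`C^{(∞)}_{v₀+z·v₁}(x,y) := vitaliLim (k ↦ ζ ↦ C^{(k+1)}_{v₀+ζ·v₁}(x,y)) z` (30's holomorphic limit along the line), `ϑ = θ^{1−λ(r)}`, `M = max(C, 4∕γ₀)`: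
(i) `C^{(k+1)}_{v₀+z·v₁}(x,y) → C^{(∞)}_{v₀+z·v₁}(x,y)`; (ii) `‖C^{(∞)}_{v₀+z·v₁}(x,y)‖ ≤ (4∕γ₀)·e^{−(1−λ(r))κ₁|x−y|_T}`;
(iii) `‖C^{(k+1)}_{v₀+z·v₁}(x,y) − C^{(∞)}_{v₀+z·v₁}(x,y)‖ ≤ C^{1−λ}·M^{λ}·e^{−(1−λ)(κ₂∕2)|x−y|_T}·ϑ^{k+1}∕(1−ϑ)`
(§2 ∕ §3 along 30's convergent sequence; `le_of_tendsto'`, `dist_le_of_le_geometric_of_tendsto`).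
[cite: King1986, §4 pp.675–676, Lemma 4.5 (4.38) p.674 (A = 0 template); Balaban1985BackgroundPropagators, Thm 3.4 p.400; Ransford1995, Thm. 4.3.7] -/
theorem kingCovCPot_line_lim_letters (hLodd : Odd L) (hL : 2 ≤ L) {a m2 : ℝ} (ha : 0 < a) (hm : 0 < m2) :
    ∃ κ₁ κ₂ w₁ C : ℝ, 0 < κ₁ ∧ 0 < κ₂ ∧ 0 < w₁ ∧ 0 < C ∧
      ∀ (e : ℕ) (v₀ v₁ : ∀ N : ℕ, Tor (fine N (kingU d L e)) → ℝ) (u₀ u₁ ν₀ ν₁ s : ℝ),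
      0 ≤ ν₀ → 0 ≤ ν₁ → ν₀ + ν₁ ≤ w₁ → 0 ≤ s → s ≤ (L : ℝ) ^ (-(1 / 2 : ℝ)) →
      0 ≤ u₀ → 0 < u₁ → u₀ < cplxWindow d a m2 L → u₀ + u₁ ≤ w₁ →
      (∀ (N : ℕ) (x : Tor (fine N (kingU d L e))), |v₀ N x| ≤ u₀) → (∀ (N : ℕ) (x : Tor (fine N (kingU d L e))), |v₁ N x| ≤ u₁) →
      (∀ (k : ℕ), 1 ≤ k → ∀ x' : Tor (fine (L ^ 1 * L ^ k) (kingU d L e)),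
          |v₀ (L ^ 1 * L ^ k) x' - v₀ (L ^ k) (underPtN L k 1 (kingU d L e) x')| ≤ ν₀ * s ^ k) →
      (∀ (k : ℕ), 1 ≤ k → ∀ x' : Tor (fine (L ^ 1 * L ^ k) (kingU d L e)),
          |v₁ (L ^ 1 * L ^ k) x' - v₁ (L ^ k) (underPtN L k 1 (kingU d L e) x')| ≤ ν₁ * s ^ k) →
      ∀ (x y : Tor (kingU d L e)) (r : ℝ), 0 < r → r < 1 →
      ∀ z : ℂ, ‖z‖ < r / (1 + r) * min ((cplxWindow d a m2 L - u₀) / u₁) 1 →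
        let f : ℕ → ℂ → ℂ := fun k ζ =>
          kingCovCPot d a m2 L (kingM d L e) (k + 1) (fun x' => (v₀ (L ^ (k + 1)) x' : ℂ) + ζ * (v₁ (L ^ (k + 1)) x' : ℂ)) x y
        Tendsto (fun k => f k z) atTop (𝓝 (vitaliLim f z)) ∧
        ‖vitaliLim f z‖ ≤ 4 / gam0L (d + 1) a L * Real.exp (-((1 - lam r) * κ₁ * tdistT (kingU d L e) x y)) ∧
        ∀ k : ℕ, ‖f k z - vitaliLim f z‖
          ≤ C ^ (1 - lam r) * (max C (4 / gam0L (d + 1) a L)) ^ lam r * Real.exp (-((1 - lam r) * (κ₂ / 2) * tdistT (kingU d L e) x y))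
              * ((((L : ℝ) ^ (-(1 / 4 : ℝ))) ^ (1 - lam r)) ^ (k + 1)) / (1 - ((L : ℝ) ^ (-(1 / 4 : ℝ))) ^ (1 - lam r)) := by
  obtain ⟨κ₁, w₁, hκ₁, hw₁, H1⟩ := kingCovCPot_line_apply_decay (d := d) L hLodd hL ha hm
  obtain ⟨κ₂, w₂, C, hκ₂, hw₂, hC, H2⟩ := kingCovCPot_line_twoSpacing_rate (d := d) L hLodd hL ha hm
  obtain ⟨w₃, hw₃, H3⟩ := king_continuumLimit_holomorphic_at (d := d) L hLodd hL ha hm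
  refine ⟨κ₁, κ₂, min w₁ (min w₂ w₃), C, hκ₁, hκ₂, lt_min hw₁ (lt_min hw₂ hw₃), hC, ?_⟩
  intro e v₀ v₁ u₀ u₁ ν₀ ν₁ s hν₀ hν₁ hνw hs0 hs1 hu₀ hu₁ hu₀K huw hv₀ hv₁ hcoh₀ hcoh₁ x y r hr0 hr1 z hz f
  have hν1 : ν₀ + ν₁ ≤ w₁ := hνw.trans (min_le_left _ _)
  have hν2 : ν₀ + ν₁ ≤ w₂ := hνw.trans ((min_le_right _ _).trans (min_le_left _ _))
  have hν3 : ν₀ + ν₁ ≤ w₃ := hνw.trans ((min_le_right _ _).trans (min_le_right _ _))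
  have hu1 : u₀ + u₁ ≤ w₁ := huw.trans (min_le_left _ _)
  have hu2 : u₀ + u₁ ≤ w₂ := huw.trans ((min_le_right _ _).trans (min_le_left _ _))
  have hu3 : u₀ + u₁ ≤ w₃ := huw.trans ((min_le_right _ _).trans (min_le_right _ _))
  obtain ⟨hrad, -⟩ := line_radius_facts (d := d) (a := a) (m2 := m2) L hr0 hu₁ hu₀K
  -- the disc lies in 30's ball of radius (r_K − u₀)/u₁
  have hzR : z ∈ ball (0 : ℂ) ((cplxWindow d a m2 L - u₀) / u₁) :=
    mem_ball_zero_iff.2 (lt_of_lt_of_le (lt_of_lt_of_le hz hrad) (min_le_left _ _))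
  obtain ⟨-, -, hconv, -, -, -, -⟩ := H3 e v₀ v₁ u₀ u₁ ν₀ ν₁ s hν₀ hν₁ hν3 hs0 hs1 hu₀ hu₁ hu₀K hu3 hv₀ hv₁ hcoh₀ hcoh₁ x y
  have hlim : Tendsto (fun k => f k z) atTop (𝓝 (vitaliLim f z)) := hconv z hzR
  -- locality at every level k+1, and the geometric rate, along the line
  have hc : ∀ k : ℕ, ‖f k z‖ ≤ 4 / gam0L (d + 1) a L * Real.exp (-((1 - lam r) * κ₁ * tdistT (kingU d L e) x y)) := fun k =>
    H1 e v₀ v₁ u₀ u₁ ν₀ ν₁ s hν₀ hν₁ hν1 hs0 hs1 hu₀ hu₁ hu₀K hu1 hv₀ hv₁ hcoh₀ hcoh₁ x y (k + 1) (Nat.succ_le_succ (Nat.zero_le k)) r hr0 hr1 z hz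
  set θ : ℝ := (L : ℝ) ^ (-(1 / 4 : ℝ)) with hθ
  set ϑ : ℝ := θ ^ (1 - lam r) with hϑ
  set A : ℝ := C ^ (1 - lam r) * (max C (4 / gam0L (d + 1) a L)) ^ lam r * Real.exp (-((1 - lam r) * (κ₂ / 2) * tdistT (kingU d L e) x y))
    with hA
  have hθ0 : 0 ≤ θ := Real.rpow_nonneg (Nat.cast_nonneg _) _
  have hθ1 : θ < 1 := by
    have hL1 : (1 : ℝ) < L := by exact_mod_cast (by omega : 1 < L)
    exact Real.rpow_lt_one_of_one_lt_of_neg hL1 (by norm_num)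
  have hlam1 := lam_lt_one r
  have hϑ1 : ϑ < 1 := Real.rpow_lt_one hθ0 hθ1 (by linarith)
  have hstep : ∀ n, dist (f n z) (f (n + 1) z) ≤ (A * ϑ) * ϑ ^ n := by
    intro n
    have h := H2 e v₀ v₁ u₀ u₁ ν₀ ν₁ s hν₀ hν₁ hν2 hs0 hs1 hu₀ hu₁ hu₀K hu2 hv₀ hv₁ hcoh₀ hcoh₁ x y (n + 1) (Nat.succ_le_succ (Nat.zero_le n))
      r hr0 hr1 z hz
    rw [dist_eq_norm, ← norm_neg, neg_sub]
    calc ‖f (n + 1) z - f n z‖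
        = ‖kingCovCPot d a m2 L (kingM d L e) (n + 1 + 1) (fun x' => (v₀ (L ^ (n + 1 + 1)) x' : ℂ) + z * (v₁ (L ^ (n + 1 + 1)) x' : ℂ)) x y
          - kingCovCPot d a m2 L (kingM d L e) (n + 1) (fun x' => (v₀ (L ^ (n + 1)) x' : ℂ) + z * (v₁ (L ^ (n + 1)) x' : ℂ)) x y‖ := rfl
      _ ≤ (C * θ ^ (n + 1)) ^ (1 - lam r) * (max C (4 / gam0L (d + 1) a L)) ^ lam r
            * Real.exp (-((1 - lam r) * (κ₂ / 2) * tdistT (kingU d L e) x y)) := h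
      _ = (A * ϑ) * ϑ ^ n := by
          have hθpow : (θ ^ (n + 1)) ^ (1 - lam r) = (θ ^ (1 - lam r)) ^ (n + 1) := by
            rw [← Real.rpow_natCast θ (n + 1), ← Real.rpow_mul hθ0, mul_comm, Real.rpow_mul hθ0, Real.rpow_natCast]
          simp only [hA, hϑ]
          rw [Real.mul_rpow hC.le (pow_nonneg hθ0 (n + 1)), hθpow, pow_succ]
          ring
  refine ⟨hlim, le_of_tendsto' hlim.norm hc, fun k => ?_⟩
  have key := dist_le_of_le_geometric_of_tendsto ϑ (A * ϑ) hϑ1 hstep hlim k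
  rw [dist_eq_norm] at key
  calc ‖f k z - vitaliLim f z‖ ≤ A * ϑ * ϑ ^ k / (1 - ϑ) := key
    _ = A * ϑ ^ (k + 1) / (1 - ϑ) := by rw [pow_succ]; ring


end Line

end Summit.QuantumFields.YangMills.BalabanUVNodes.N15.KingModel

end
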